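import Summits.CriticalPhenomena.PercolationContinuityZ3.Theorems.Transplant.Slab111HubS03P27
import Summits.CriticalPhenomena.PercolationContinuityZ3.Theorems.Transplant.Slab111HubS03P28
import Summits.CriticalPhenomena.PercolationContinuityZ3.Theorems.Transplant.Slab111HubS03P29
import Summits.CriticalPhenomena.PercolationContinuityZ3.Theorems.Transplant.Slab111HubS03P30
import HarnessLib

/-!
# The HUB ROUTING of the `(111)`-films — dispatcher tables of the shape `S03`: ROW THEOREMS `rowS03_17` (file R3)

builds on p205010 (kernel theorem, internal audit signed; external expert review pending) — NOT used in this file.  Lane `prim-bschramm`, seat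
`prim-bschramm-p2` (gen 36; class C1b; memo `HOME/bschramm/P2-LATTICES.md` §131); helper file (`--supports stmt-CriticalPhenomena-4575 --as helper`).
Machine-generated (`emit_tables6.py` + `flatten.py`): for each first terminal column `q₁` listed, the row theorem `rowS03_i` collecting the kernel-checked
entries `tabS03_i_j` of the part files `Slab111HubS03P*` over all nonzero region columns `q₂`.
[cite: DuminilCopinSidoraviciusTassion2016, §2.3 (proof of Fact 2: the three disjoint paths γ_u, γ_v, γ_w in B_R(z))]
-/

namespace Summit.CriticalPhenomena.PercolationContinuityZ3.Theorems.Transplant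

namespace Slab111

/-- **Row `q₁ = (2, -3)` of the tables of shape `S03`.** [folklore] -/
theorem rowS03_17 : ∀ q₂ ∈ shapeS03.cols, q₂ ≠ (0, 0) → shapeS03.pcB q₂ = true →
    ∃ A C : ℕ, tab4OK shapeS03.pcB shapeS03.colsB shapeS03.badG shapeS03.filtG shapeS03.cols ((2 : ℤ), (-3 : ℤ)) q₂ A C = true := by
  intro q₂ h₂ h02 hp2
  have h₂' : q₂ ∈ ([(0, 0), (1, 0), (0, -1), (-1, 1), (-1, 0), (0, 1), (1, -1), (2, 0), (0, -2), (-2, 2), (-2, 0), (0, 2), (2, -2), (1, 1), (2, -1), (1, -2), (-1, -1), (-2, 1), (-1, 2), (-3, 1), (-3, 2), (-2, -1), (-2, 3), (-1, -2), (-1, 3), (0, 3), (1, -3), (1, 2), (2, -3), (2, 1), (3, -2), (3, -1), (3, 0)] : List (ℤ × ℤ)) := h₂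
  simp only [List.mem_cons, List.not_mem_nil, or_false] at h₂'
  rcases h₂' with rfl | rfl | rfl | rfl | rfl | rfl | rfl | rfl | rfl | rfl | rfl | rfl | rfl | rfl | rfl | rfl | rfl | rfl | rfl | rfl | rfl | rfl | rfl | rfl | rfl | rfl | rfl | rfl | rfl | rfl | rfl | rfl | rfl
  · exact absurd rfl h02
  · exact absurd hp2 (by decide)
  · exact ⟨_, _, tabS03_17_1⟩
  · exact ⟨_, _, tabS03_17_2⟩
  · exact ⟨_, _, tabS03_17_3⟩
  · exact absurd hp2 (by decide)
  · exact ⟨_, _, tabS03_17_4⟩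
  · exact absurd hp2 (by decide)
  · exact ⟨_, _, tabS03_17_5⟩
  · exact ⟨_, _, tabS03_17_6⟩
  · exact ⟨_, _, tabS03_17_7⟩
  · exact absurd hp2 (by decide)
  · exact ⟨_, _, tabS03_17_8⟩
  · exact absurd hp2 (by decide)
  · exact absurd hp2 (by decide)
  · exact ⟨_, _, tabS03_17_9⟩
  · exact ⟨_, _, tabS03_17_10⟩
  · exact ⟨_, _, tabS03_17_11⟩
  · exact absurd hp2 (by decide)
  · exact ⟨_, _, tabS03_17_12⟩
  · exact ⟨_, _, tabS03_17_13⟩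
  · exact ⟨_, _, tabS03_17_14⟩
  · exact absurd hp2 (by decide)
  · exact ⟨_, _, tabS03_17_15⟩
  · exact absurd hp2 (by decide)
  · exact absurd hp2 (by decide)
  · exact ⟨_, _, tabS03_17_16⟩
  · exact absurd hp2 (by decide)
  · exact ⟨_, _, tabS03_17_17⟩
  · exact absurd hp2 (by decide)
  · exact absurd hp2 (by decide)
  · exact absurd hp2 (by decide)
  · exact absurd hp2 (by decide)

end Slab111

end Summit.CriticalPhenomena.PercolationContinuityZ3.Theorems.Transplant
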